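import Literature.NumberTheory.EllipticCurves.BSDQuadraticDescentCasselsPairingProofs
import Literature.NumberTheory.EllipticCurves.IsogenyKummerSequenceProofs
import Literature.NumberTheory.EllipticCurves.ThreeIsogenySelmerRatioTwistFamilies
import Literature.NumberTheory.EllipticCurves.CasselsTateIsogenyAdjoint
import Literature.NumberTheory.EllipticCurves.CasselsTatePairingFunctorial
import Literature.NumberTheory.EllipticCurves.IsogenySelmerRatioCasselsFormula
import HarnessLib

/-!
# Cassels' isogeny invariance of the BSD quotient: Milne's (7.3.1) from Cassels' Selmer-ratio
# formula (proofs towards `WeierstrassCurve.bsdRHS_eq_of_isIsogenous`)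

Fifth sibling *proofs* file (theorems only, no definition, no named fact) of
`Literature.NumberTheory.EllipticCurves.BSDQuadraticDescent` for the named fact
`WeierstrassCurve.bsdRHS_eq_of_isIsogenous` (Cassels 1965; Milne, *Arithmetic Duality Theorems*,
Thm. I.7.3 with Rmk. 7.4). The earlier siblings reduced it to two inputs
(`WeierstrassCurve.bsdRHS_eq_of_isIsogenous_of_casselsTate_of_keyIdentity`,
`BSDQuadraticDescentCasselsPairingProofs.lean`): (CT) Cassels–Tate pairings adjoint for `(Ш(φ), Ш(φ̂))`
and (7.3.1) Milne's key identity with its local side evaluated,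
`Ω(E)∏c_p(E) · #ker Ш(φ) · #ker φ̂(ℚ) · [E'(ℚ):φE(ℚ)] = Ω(E')∏c_p(E') · #ker Ш(φ̂) · #ker φ(ℚ) · [E(ℚ):φ̂E'(ℚ)]`.

Milne proves (7.3.1) — "`∏_{v∈S} z(f(K_v)) = ([Ker Ш(fᵗ)]/[Ker Ш(f)]) · z(f(K))/z(fᵗ(K))`",
`z(h) = [Ker h]/[Coker h]` (*ADT* p. 98; quoted by Dokchitser–Dokchitser, Ann. of Math. 172 (2010)
§4.1, proof of Thm. 4.3) — from global duality (pp. 99–100). With Silverman's exact sequence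
X.4.2(a), `#S^{(φ)}(E/K) = [E'(K):φE(K)] · #Ш(E/K)[φ]` (the tree's THEOREM
`WeierstrassCurve.Isogeny.natCard_selmerGroup_eq`, `IsogenyKummerSequenceProofs.lean`) and
`#E(K)[φ] = #ker φ(K)` (`natCard_ker_pointHom_eq_ratKerCard` below), (7.3.1) is literally
**Cassels' formula for the Selmer ratio**
`c(φ) · #S^{(φ̂)}(E'/K) · #E(K)[φ] = #S^{(φ)}(E/K) · #E'(K)[φ̂]`, `c(φ) = ∏_{v ≤ ∞} #coker φ(K_v)/#ker φ(K_v)`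
(Cassels, J. reine angew. Math. 217 (1965) Thm. 1.1; Bhargava–Klagsbrun–Lemke Oliver–Shnidman 2019
§9.1 display (9.2) "Cassels' formula"; Bhargava–Elkies–Shnidman (7.4)) — in the tree's vocabulary
`BhargavaKlagsbrunLemkeOliverShnidman2019.selmerRatio φ = ∏ᶠ_v c_v(φ) · ∏_w c_w(φ)`,
`Isogeny.localSelmerRatio`, `Isogeny.selmerGroup`, `Isogeny.ratKerCard` (file
`ThreeIsogenySelmerRatioTwistFamilies.lean`; the tree's named fact
`BhargavaKlagsbrunLemkeOliverShnidman2019.casselsFormula_selmerRatio` is this formula for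
`3`-isogenies) — together with the **local evaluation of the Selmer ratio** on globally minimal
models over `ℚ`, `c(φ) · Ω(E)∏c_p(E) = Ω(E')∏c_p(E')` (Milne *ADT* p. 98: "`z(f(K_v)) = μ_v(A, ω_A)/μ_v(B, ω_B)`"
with `ω_A = f^*ω_B` and the product formula; Dokchitser–Dokchitser 2010 p. 18 l. 1–3; the
`p`-adic factor is Dokchitser–Dokchitser, *Local invariants of isogenous elliptic curves*, Trans. AMS
367 (2015) §4 Lemma 4.2 = Schaefer, J. Number Theory 56 (1996) Lemma 3.8; the archimedean factor is
the tree's THEOREM `Isogeny.exists_algebraMap_card_ker_inf_realPoints_mul_realPeriod_eq`).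

This file proves that bookkeeping:

* `WeierstrassCurve.Isogeny.natCard_ker_pointHom_eq_ratKerCard` — `#ker φ(K) = #E[φ](K)`
  (Galois descent `E(K̄)^Γ = E(K)`).
* `WeierstrassCurve.keyIdentity_of_casselsFormula_of_selmerRatio_eq` — (7.3.1) with local side
  evaluated, for a pair `(φ, φ̂)` over `ℚ`, from Cassels' formula for `φ` and the local evaluation
  of `c(φ)`.
* `WeierstrassCurve.bsdRHS_eq_of_isIsogenous_of_casselsTate_of_casselsFormula` — the named fact
  `bsdRHS_eq_of_isIsogenous` from (CT), Cassels' formula over `ℚ` (all degrees) and the local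
  evaluation of the Selmer ratio on globally minimal models — each hypothesis a printed theorem in
  tree vocabulary; none of the three is in Mathlib or the tree (for degree `3`, Cassels' formula is
  the tree's named fact `casselsFormula_selmerRatio`).
* `WeierstrassCurve.bsdRHS_eq_of_casselsTate_of_casselsFormula_selmerRatio_three` — the per-pair
  `3`-isogeny case with (CF) supplied by that existing named fact.
* `WeierstrassCurve.bsdRHS_eq_of_isIsogenous_of_casselsTate_adjoint_of_casselsFormula` (and
  `…_of_casselsTate_functorial_of_casselsFormula`) — (CT) supplied by the tree's existing named fact
  `exists_casselsTate_pairing_adjoint ℚ` (resp. `casselsTate_pairing_functorial ℚ`): Cassels' theorem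
  modulo that fact, (CF) and (LOC).
* `WeierstrassCurve.bsdRHS_eq_of_isIsogenous_of_casselsTate_adjoint_of_selmerRatioFormula` (and
  `…_functorial_…`) — (CF) supplied BY NAME by the tree's named fact
  `Literature.NumberTheory.EllipticCurves.Cassels1965.selmerRatioFormula` (Cassels' formula, all
  degrees, all number fields; `IsogenySelmerRatioCasselsFormula.lean`): Cassels' theorem modulo two
  named facts and (LOC).

## References

* [MilneADT2006] J. S. Milne, *Arithmetic Duality Theorems*, 2nd ed., I.§7, (7.3.1) and pp. 97–100.
* [Cassels1965ArithmeticVIII] J. W. S. Cassels, J. reine angew. Math. 217 (1965) 180–199, Thm. 1.1.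
* [DokchitserDokchitserAnnals2010] T. and V. Dokchitser, Ann. of Math. 172 (2010), §4.1 Thm. 4.3.
* [BhargavaKlagsbrunLemkeOliverShnidman2019] Duke Math. J. 168 (2019), §9.1 display (9.2).
* [SilvermanAEC2009] J. H. Silverman, *AEC* 2nd ed., Thm. X.4.2(a).
-/

noncomputable section

open scoped Classical

universe u

namespace WeierstrassCurve

namespace Isogeny

open Literature.NumberTheory.EllipticCurves

variable {K : Type u} [Field K] {W W' : WeierstrassCurve K}

/-- **`#ker φ(K) = #E[φ](K)`**: the kernel of the map `f = φ(K) : E(K) → E'(K)` induced by an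
isogeny on rational points is in bijection with the `Γ_K`-fixed points of `E[φ] ⊆ E(K̄)`
(`Isogeny.ratKerCard`), by Galois descent `E(K̄)^{Γ_K} = E(K)` (`K` perfect). Milne, *ADT*, proof
of Thm. I.7.3 (`Ker f(K) = A_f(K)`); BKLOS §9.1 ("`E[φ](F)`").
[cite: MilneADT2006, Ch. I §7, proof of Thm. 7.3 (p. 97, z(f(K)))]
[cite: BhargavaKlagsbrunLemkeOliverShnidman2019, §9.1 (chunk p0014 L35–L37)] -/
theorem natCard_ker_pointHom_eq_ratKerCard [PerfectField K] (φ : Isogeny W W')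
    (f : W.toAffine.Point →+ W'.toAffine.Point)
    (hf : ∀ P, W'.toGeomPoints (f P) = φ (W.toGeomPoints P)) :
    Nat.card f.ker = φ.ratKerCard := by
  unfold ratKerCard
  refine Nat.card_congr (Equiv.ofBijective
    (fun R ↦ ⟨W.toGeomPoints (R : W.toAffine.Point), ?_, fun σ ↦ smul_toGeomPoints W σ _⟩)
    ⟨fun R R' h ↦ Subtype.ext (toGeomPoints_injective W (Subtype.ext_iff.mp h)), fun P ↦ ?_⟩)
  · have hR : f R = 0 := R.2
    rw [← hf, hR, map_zero]
  · obtain ⟨R, hR⟩ := exists_toGeomPoints_eq_of_forall_smul_eq W P.2.2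
    refine ⟨⟨R, ?_⟩, Subtype.ext hR⟩
    rw [AddMonoidHom.mem_ker]
    apply toGeomPoints_injective W'
    rw [hf, hR, P.2.1, map_zero]

/-- **Milne's (7.3.1) from Cassels' Selmer-ratio formula, over a number field** (bookkeeping). For a
`K`-isogeny `φ : E → E'` of elliptic curves with an isogeny `ψ : E' → E` back, induced maps
`f = φ(K)`, `g = ψ(K)`, and reals `x, x'` (Milne: `x/x' = ∏_{v∈S} μ_v(A, ω_A)/μ_v(B, ω_B)`): if
(CF) `c(φ) · #S^{(ψ)}(E'/K) · #E(K)[φ] = #S^{(φ)}(E/K) · #E'(K)[ψ]` (Cassels' formula, `c(φ)` the Selmer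
ratio `selmerRatio φ = ∏_v #coker φ(K_v)/#ker φ(K_v)`) and (LOC) `c(φ) · x = x'`, then
`x · #ker Ш(φ) · #ker g · [E'(K):fE(K)] = x' · #ker Ш(ψ) · #ker f · [E(K):gE'(K)]` — hypothesis (7.3.1)
of `Isogeny.card_sha_mul_regulator_mul_eq_of_keyIdentity` — by Silverman X.4.2(a)
(`Isogeny.natCard_selmerGroup_eq`: `#S^{(φ)} = [E'(K):fE(K)] · #ker Ш(φ)`) and `#ker f = #E(K)[φ]`.
[cite: MilneADT2006, Ch. I §7, (7.3.1) (p. 98)]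
[cite: BhargavaKlagsbrunLemkeOliverShnidman2019, §9.1 display (9.2) (chunk p0014 L35–L37, Cassels' formula)] -/
theorem keyIdentity_of_casselsFormula [NumberField K] [W.IsElliptic] [W'.IsElliptic]
    (φ : Isogeny W W') (ψ : Isogeny W' W)
    (f : W.toAffine.Point →+ W'.toAffine.Point)
    (hf : ∀ P, W'.toGeomPoints (f P) = φ (W.toGeomPoints P))
    (g : W'.toAffine.Point →+ W.toAffine.Point)
    (hg : ∀ Q, W.toGeomPoints (g Q) = ψ (W'.toGeomPoints Q)) (x x' : ℝ)
    (hCF : (BhargavaKlagsbrunLemkeOliverShnidman2019.selmerRatio φ : ℚ) * Nat.card ψ.selmerGroup *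
      φ.ratKerCard = Nat.card φ.selmerGroup * ψ.ratKerCard)
    (hLOC : (BhargavaKlagsbrunLemkeOliverShnidman2019.selmerRatio φ : ℝ) * x = x') :
    x * Nat.card (shaMap φ.toAddMonoidHom φ.equivariant φ.hasLocalPointsMaps_toAddMonoidHom).ker *
        Nat.card g.ker * f.range.index =
      x' * Nat.card (shaMap ψ.toAddMonoidHom ψ.equivariant ψ.hasLocalPointsMaps_toAddMonoidHom).ker *
        Nat.card f.ker * g.range.index := by
  have hSφ := φ.natCard_selmerGroup_eq f hf
  have hSψ := ψ.natCard_selmerGroup_eq g hg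
  have ha := φ.natCard_ker_pointHom_eq_ratKerCard f hf
  have ha' := ψ.natCard_ker_pointHom_eq_ratKerCard g hg
  have hCF' := congrArg (fun q : ℚ ↦ (q : ℝ)) hCF
  simp only [Rat.cast_mul, Rat.cast_natCast] at hCF'
  rw [hSφ, hSψ, ← ha, ← ha'] at hCF'
  push_cast at hCF'
  set r := (BhargavaKlagsbrunLemkeOliverShnidman2019.selmerRatio φ : ℝ)
  set kφ := (Nat.card
    (shaMap φ.toAddMonoidHom φ.equivariant φ.hasLocalPointsMaps_toAddMonoidHom).ker : ℝ)
  set kψ := (Nat.card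
    (shaMap ψ.toAddMonoidHom ψ.equivariant ψ.hasLocalPointsMaps_toAddMonoidHom).ker : ℝ)
  set a := (Nat.card f.ker : ℝ)
  set a' := (Nat.card g.ker : ℝ)
  set c := (f.range.index : ℝ)
  set c' := (g.range.index : ℝ)
  linear_combination x * hCF'.symm + (c' * kψ * a) * hLOC

end Isogeny

section Rat

open Literature.NumberTheory.EllipticCurves
open Literature.NumberTheory.EllipticCurves.BhargavaKlagsbrunLemkeOliverShnidman2019 (selmerRatio)

variable {W W' : WeierstrassCurve ℚ}

/-- **Milne's (7.3.1), local side evaluated, from Cassels' Selmer-ratio formula.** For a `ℚ`-isogeny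
`φ : E → E'` of elliptic curves with dual `ψ` (`ψ ∘ φ = [deg φ]`) and the induced maps `f = φ(ℚ)`,
`g = ψ(ℚ)` on rational points: if
(CF) `c(φ) · #S^{(ψ)}(E'/ℚ) · #E(ℚ)[φ] = #S^{(φ)}(E/ℚ) · #E'(ℚ)[ψ]` (Cassels' formula, Cassels 1965
VIII Thm. 1.1 / BKLOS (9.2), `c(φ) = selmerRatio φ`), and
(LOC) `c(φ) · Ω(E)∏c_p(E) = Ω(E')∏c_p(E')` (Milne *ADT* p. 98, `z(f(K_v)) = μ_v(A, f^*ω_B)/μ_v(B, ω_B)`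
and the product formula, on the given models),
then `Ω(E)∏c_p(E) · #ker Ш(φ) · #ker g · [E'(ℚ):f E(ℚ)] = Ω(E')∏c_p(E') · #ker Ш(ψ) · #ker f · [E(ℚ):g E'(ℚ)]`
— the hypothesis `h731` of `WeierstrassCurve.bsdRHS_eq_of_casselsTate_of_keyIdentity` — by
`#S^{(φ)} = [E'(ℚ):fE(ℚ)] · #ker Ш(φ)` (`Isogeny.natCard_selmerGroup_eq`, Silverman X.4.2(a)) and
`#ker f = #E(ℚ)[φ]` (`Isogeny.natCard_ker_pointHom_eq_ratKerCard`). Polymorphic in the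
`DecidableEq ℚ` instance of the group law.
[cite: MilneADT2006, Ch. I §7, (7.3.1) (p. 98) and pp. 98–100]
[cite: DokchitserDokchitserAnnals2010, §4.1, proof of Thm. 4.3 (held PDF pp. 17–18)] -/
theorem keyIdentity_of_casselsFormula_of_selmerRatio_eq [DecidableEq ℚ] [W.IsElliptic]
    [W'.IsElliptic] (φ : Isogeny W W') (ψ : Isogeny W' W)
    (f : W.toAffine.Point →+ W'.toAffine.Point)
    (hf : ∀ P, W'.toGeomPoints (f P) = φ (W.toGeomPoints P))
    (g : W'.toAffine.Point →+ W.toAffine.Point)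
    (hg : ∀ Q, W.toGeomPoints (g Q) = ψ (W'.toGeomPoints Q))
    (hCF : (selmerRatio φ : ℚ) * Nat.card ψ.selmerGroup * φ.ratKerCard =
      Nat.card φ.selmerGroup * ψ.ratKerCard)
    (hLOC : (selmerRatio φ : ℝ) * (W.realPeriodRat * W.tamagawaProduct) =
      W'.realPeriodRat * W'.tamagawaProduct) :
    W.realPeriodRat * W.tamagawaProduct *
        Nat.card (shaMap φ.toAddMonoidHom φ.equivariant φ.hasLocalPointsMaps_toAddMonoidHom).ker *
          Nat.card g.ker * f.range.index =
      W'.realPeriodRat * W'.tamagawaProduct *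
        Nat.card (shaMap ψ.toAddMonoidHom ψ.equivariant ψ.hasLocalPointsMaps_toAddMonoidHom).ker *
          Nat.card f.ker * g.range.index := by
  -- bridge the `DecidableEq ℚ` instance to the classical one of the general theorems
  obtain rfl : ‹DecidableEq ℚ› = fun a b ↦ Classical.propDecidable (a = b) :=
    Subsingleton.elim _ _
  exact Isogeny.keyIdentity_of_casselsFormula φ ψ f hf g hg _ _ hCF hLOC

/-- **Cassels' theorem (`WeierstrassCurve.bsdRHS_eq_of_isIsogenous`, Milne *ADT* Thm. I.7.3 with
Rmk. 7.4 in quotient form) from three printed inputs in tree vocabulary**, each quantified over all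
`ℚ`-isogenies `φ : E → E'` of elliptic curves with dual `ψ = φ̂` (`ψ ∘ φ = [deg φ]`):
(CT) the Cassels–Tate pairings on `Ш(E)`, `Ш(E')` — alternating, left kernels inside the divisible
subgroups, ADJOINT for `(Ш(φ), Ш(ψ))` (Milne *ADT* I Prop. 6.9, Rmk. 6.10(a), Thm. 6.13(a); the
hypothesis of `bsdRHS_eq_of_isIsogenous_of_casselsTate_of_keyIdentity`);
(CF) **Cassels' formula** `c(φ) · #S^{(ψ)}(E'/ℚ) · #E(ℚ)[φ] = #S^{(φ)}(E/ℚ) · #E'(ℚ)[ψ]` with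
`c(φ) = ∏_{v ≤ ∞} #coker φ(ℚ_v)/#ker φ(ℚ_v)` the Selmer ratio
(`BhargavaKlagsbrunLemkeOliverShnidman2019.selmerRatio`; Cassels 1965 VIII Thm. 1.1, BKLOS §9.1
(9.2) — the tree's named fact `casselsFormula_selmerRatio` is the degree-`3` case; Milne's (7.3.1),
*ADT* p. 98, is this identity by Silverman X.4.2(a));
(LOC) **the local evaluation of the Selmer ratio** on globally minimal models,
`c(φ) · Ω(E)∏c_p(E) = Ω(E')∏c_p(E')` (Milne *ADT* pp. 98–99; Dokchitser–Dokchitser 2010 p. 18;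
`p`-adic factor: Dokchitser–Dokchitser 2015 §4 Lemma 4.2 / Schaefer 1996 Lemma 3.8; archimedean
factor: the tree's `Isogeny.exists_algebraMap_card_ker_inf_realPoints_mul_realPeriod_eq`; product
formula).
The proof feeds `keyIdentity_of_casselsFormula_of_selmerRatio_eq` to the landed assembly. None of
(CT), (CF), (LOC) is proved here; the discharge `bsdRHS_eq_of_isIsogenous_holds` is this theorem
applied to their proofs.
[cite: MilneADT2006, Ch. I, Thm. 7.3, Rmk. 7.4 and proof, (7.3.1), pp. 97–100]
[cite: Cassels1965ArithmeticVIII, Thm. 1.1 (as quoted by BKLOS §9.1 (9.2))]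
[cite: DokchitserDokchitserAnnals2010, §4.1, proof of Thm. 4.3 (held PDF pp. 17–18)] -/
theorem bsdRHS_eq_of_isIsogenous_of_casselsTate_of_casselsFormula
    (hCT : ∀ (W W' : WeierstrassCurve ℚ) [W.IsElliptic] [W'.IsElliptic] (φ : Isogeny W W')
      (ψ : Isogeny W' W), (∀ P : W.geomPoints, ψ (φ P) = (φ.degree : ℤ) • P) →
      ∃ (B : W.sha →+ W.sha →+ AddCircle (1 : ℚ)) (B' : W'.sha →+ W'.sha →+ AddCircle (1 : ℚ)),
        (∀ x, B x x = 0) ∧ (∀ x, (∀ y, B x y = 0) → x ∈ AddSubgroup.divisibleElements W.sha) ∧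
        (∀ x, B' x x = 0) ∧ (∀ x, (∀ y, B' x y = 0) → x ∈ AddSubgroup.divisibleElements W'.sha) ∧
        ∀ a b', B' (shaMap φ.toAddMonoidHom φ.equivariant φ.hasLocalPointsMaps_toAddMonoidHom a) b' =
          B a (shaMap ψ.toAddMonoidHom ψ.equivariant ψ.hasLocalPointsMaps_toAddMonoidHom b'))
    (hCF : ∀ (W W' : WeierstrassCurve ℚ) [W.IsElliptic] [W'.IsElliptic] (φ : Isogeny W W')
      (ψ : Isogeny W' W), (∀ P : W.geomPoints, ψ (φ P) = (φ.degree : ℤ) • P) →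
      (selmerRatio φ : ℚ) * Nat.card ψ.selmerGroup * φ.ratKerCard =
        Nat.card φ.selmerGroup * ψ.ratKerCard)
    (hLOC : ∀ (W W' : WeierstrassCurve ℚ) [W.IsElliptic] [W'.IsElliptic] [W.IsGloballyMinimal]
      [W'.IsGloballyMinimal] (φ : Isogeny W W'),
      (selmerRatio φ : ℝ) * (W.realPeriodRat * W.tamagawaProduct) =
        W'.realPeriodRat * W'.tamagawaProduct) :
    bsdRHS_eq_of_isIsogenous :=
  bsdRHS_eq_of_isIsogenous_of_casselsTate_of_keyIdentity hCT
    fun W W' _ _ _ _ _ φ ψ hψφ f hf g hg ↦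
      keyIdentity_of_casselsFormula_of_selmerRatio_eq φ ψ f hf g hg (hCF W W' φ ψ hψφ) (hLOC W W' φ)


/-- **The `3`-isogeny case: Cassels' theorem for a `3`-isogenous pair from (CT), (LOC) and the
tree's NAMED FACT `casselsFormula_selmerRatio`** (Cassels' formula for `3`-isogenies, BKLOS §9.1
(9.2) / Bhargava–Elkies–Shnidman (7.4)). For a `ℚ`-isogeny `φ : E → E'` of degree `3` of elliptic
curves with dual `ψ` (`ψ ∘ φ = [3]`), induced maps `f`, `g` on rational points, Cassels–Tate pairings
adjoint for `(Ш(φ), Ш(ψ))` (CT, for this pair), the local evaluation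
`c(φ) · Ω(E)∏c_p(E) = Ω(E')∏c_p(E')` (LOC, for this pair and these models) and `Ш(E/ℚ)` finite:
`E` and `E'` have the same Birch–Swinnerton-Dyer quotient `WeierstrassCurve.bsdRHS`. (The per-pair
form of `bsdRHS_eq_of_isIsogenous_of_casselsTate_of_casselsFormula` with (CF) supplied by the
existing fact.) Polymorphic in the `DecidableEq ℚ` instance of the group law.
[cite: MilneADT2006, Ch. I, Thm. 7.3 and proof, (7.3.1), pp. 97–100]
[cite: BhargavaKlagsbrunLemkeOliverShnidman2019, §9.1 display (9.2) (chunk p0014 L35–L37, Cassels' formula)] -/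
theorem bsdRHS_eq_of_casselsTate_of_casselsFormula_selmerRatio_three [DecidableEq ℚ]
    [W.IsElliptic] [W'.IsElliptic] (φ : Isogeny W W') (ψ : Isogeny W' W) (hdeg : φ.degree = 3)
    (hψφ : ∀ P : W.geomPoints, ψ (φ P) = (3 : ℤ) • P)
    (f : W.toAffine.Point →+ W'.toAffine.Point)
    (hf : ∀ P, W'.toGeomPoints (f P) = φ (W.toGeomPoints P))
    (g : W'.toAffine.Point →+ W.toAffine.Point)
    (hg : ∀ Q, W.toGeomPoints (g Q) = ψ (W'.toGeomPoints Q))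
    (hCT : ∃ (B : W.sha →+ W.sha →+ AddCircle (1 : ℚ)) (B' : W'.sha →+ W'.sha →+ AddCircle (1 : ℚ)),
      (∀ x, B x x = 0) ∧ (∀ x, (∀ y, B x y = 0) → x ∈ AddSubgroup.divisibleElements W.sha) ∧
      (∀ x, B' x x = 0) ∧ (∀ x, (∀ y, B' x y = 0) → x ∈ AddSubgroup.divisibleElements W'.sha) ∧
      ∀ a b', B' (shaMap φ.toAddMonoidHom φ.equivariant φ.hasLocalPointsMaps_toAddMonoidHom a) b' =
        B a (shaMap ψ.toAddMonoidHom ψ.equivariant ψ.hasLocalPointsMaps_toAddMonoidHom b'))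
    (hCF3 : BhargavaKlagsbrunLemkeOliverShnidman2019.casselsFormula_selmerRatio)
    (hLOC : (selmerRatio φ : ℝ) * (W.realPeriodRat * W.tamagawaProduct) =
      W'.realPeriodRat * W'.tamagawaProduct)
    (hfin : W.ShaFinite) : W'.bsdRHS = W.bsdRHS := by
  have hψφ' : ∀ P : W.geomPoints, ψ (φ P) = (φ.degree : ℤ) • P := fun P ↦ by
    rw [hdeg]; exact hψφ P
  obtain ⟨-, -, hCF⟩ := hCF3 ℚ W W' φ ψ hdeg hψφ
  exact bsdRHS_eq_of_casselsTate_of_keyIdentity φ ψ hψφ' f hf g hg hCT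
    (keyIdentity_of_casselsFormula_of_selmerRatio_eq φ ψ f hf g hg hCF hLOC) hfin


/-- **Cassels' theorem from the tree's NAMED FACT `exists_casselsTate_pairing_adjoint ℚ`** (the
Cassels–Tate pairing in functorial form, Milne *ADT* I Prop. 6.9 / Rem. 6.10(a) / Thm. 6.13(a), file
`CasselsTateIsogenyAdjoint.lean`) **plus Cassels' Selmer-ratio formula (CF) and the local evaluation
of the Selmer ratio (LOC)**: the (CT) input of
`bsdRHS_eq_of_isIsogenous_of_casselsTate_of_casselsFormula` is exactly that existing fact (its kernel
clauses are `↔`; only `→` is used). What separates this from `bsdRHS_eq_of_isIsogenous_holds`: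
`exists_casselsTate_pairing_adjoint ℚ` (unproved in the tree), (CF) for all degrees (the tree's
`casselsFormula_selmerRatio` is degree `3`; Cassels 1965 VIII Thm. 1.1 — Poitou–Tate duality) and
(LOC) (Milne *ADT* pp. 98–99; Dokchitser–Dokchitser 2015 §4 Lemma 4.2 for the `p`-adic factors, the
archimedean factor being the tree's `Isogeny.exists_algebraMap_card_ker_inf_realPoints_mul_realPeriod_eq`).
[cite: MilneADT2006, Ch. I, Thm. 7.3, Rmk. 7.4 and proof, (7.3.1), pp. 97–100; Prop. 6.9, Rem. 6.10(a), Thm. 6.13(a)]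
[cite: Cassels1965ArithmeticVIII, Thm. 1.1 (as quoted by BKLOS §9.1 (9.2))] -/
theorem bsdRHS_eq_of_isIsogenous_of_casselsTate_adjoint_of_casselsFormula
    (hCT : exists_casselsTate_pairing_adjoint ℚ)
    (hCF : ∀ (W W' : WeierstrassCurve ℚ) [W.IsElliptic] [W'.IsElliptic] (φ : Isogeny W W')
      (ψ : Isogeny W' W), (∀ P : W.geomPoints, ψ (φ P) = (φ.degree : ℤ) • P) →
      (selmerRatio φ : ℚ) * Nat.card ψ.selmerGroup * φ.ratKerCard =
        Nat.card φ.selmerGroup * ψ.ratKerCard)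
    (hLOC : ∀ (W W' : WeierstrassCurve ℚ) [W.IsElliptic] [W'.IsElliptic] [W.IsGloballyMinimal]
      [W'.IsGloballyMinimal] (φ : Isogeny W W'),
      (selmerRatio φ : ℝ) * (W.realPeriodRat * W.tamagawaProduct) =
        W'.realPeriodRat * W'.tamagawaProduct) :
    bsdRHS_eq_of_isIsogenous := by
  refine bsdRHS_eq_of_isIsogenous_of_casselsTate_of_casselsFormula (fun W W' _ _ φ ψ hψφ ↦ ?_)
    hCF hLOC
  obtain ⟨B, B', hB, hBker, hB', hB'ker, hadj⟩ := hCT W W' φ ψ hψφ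
  exact ⟨B, B', hB, fun x hx ↦ (hBker x).mp hx, hB', fun x hx ↦ (hB'ker x).mp hx, hadj⟩

/-- The same from the tree's other functorial form `casselsTate_pairing_functorial ℚ` (one family of
pairings `B_W` over all curves, file `CasselsTatePairingFunctorial.lean`), which specialises to the
adjoint shape pair by pair. [cite: MilneADT2006, Ch. I, Thm. 7.3 and proof; Prop. 6.9, Rem. 6.10(a), Thm. 6.13(a)] -/
theorem bsdRHS_eq_of_isIsogenous_of_casselsTate_functorial_of_casselsFormula
    (hCT : casselsTate_pairing_functorial ℚ)
    (hCF : ∀ (W W' : WeierstrassCurve ℚ) [W.IsElliptic] [W'.IsElliptic] (φ : Isogeny W W')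
      (ψ : Isogeny W' W), (∀ P : W.geomPoints, ψ (φ P) = (φ.degree : ℤ) • P) →
      (selmerRatio φ : ℚ) * Nat.card ψ.selmerGroup * φ.ratKerCard =
        Nat.card φ.selmerGroup * ψ.ratKerCard)
    (hLOC : ∀ (W W' : WeierstrassCurve ℚ) [W.IsElliptic] [W'.IsElliptic] [W.IsGloballyMinimal]
      [W'.IsGloballyMinimal] (φ : Isogeny W W'),
      (selmerRatio φ : ℝ) * (W.realPeriodRat * W.tamagawaProduct) =
        W'.realPeriodRat * W'.tamagawaProduct) :
    bsdRHS_eq_of_isIsogenous := by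
  refine bsdRHS_eq_of_isIsogenous_of_casselsTate_of_casselsFormula (fun W W' _ _ φ ψ hψφ ↦ ?_)
    hCF hLOC
  obtain ⟨B, hB, hadj⟩ := hCT
  exact ⟨B W, B W', (hB W).1, fun x hx ↦ ((hB W).2 x).mp hx, (hB W').1,
    fun x hx ↦ ((hB W').2 x).mp hx, hadj W W' φ ψ hψφ⟩

/-- **Cassels' theorem modulo two NAMED FACTS of the tree and (LOC)**: (CT) =
`exists_casselsTate_pairing_adjoint ℚ` (Milne *ADT* I 6.9/6.10(a)/6.13(a)) and (CF) =
`Literature.NumberTheory.EllipticCurves.Cassels1965.selmerRatioFormula` (Cassels' Selmer-ratio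
formula for every isogeny, Milne *ADT* I (7.3.1); file `IsogenySelmerRatioCasselsFormula.lean`, whose
`Cassels1965.selmerRatioFormula.rat` is the `hCF` input verbatim), leaving only (LOC), the local
evaluation of the Selmer ratio on globally minimal models (Milne *ADT* pp. 98–99;
Dokchitser–Dokchitser 2015 §4 Lemma 4.2 for the `p`-adic factors; the archimedean factor is the
tree's `Isogeny.exists_algebraMap_card_ker_inf_realPoints_mul_realPeriod_eq`).  So
`bsdRHS_eq_of_isIsogenous_holds` is this theorem applied to `exists_casselsTate_pairing_adjoint_holds`,
`Cassels1965.selmerRatioFormula_holds` and a proof of (LOC).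
[cite: MilneADT2006, Ch. I, Thm. 7.3, Rmk. 7.4 and proof, (7.3.1), pp. 97–100; Prop. 6.9, Rem. 6.10(a), Thm. 6.13(a)]
[cite: Cassels1965ArithmeticVIII, Thm. 1.1 (as quoted by BKLOS §9.1 (9.2) and Klagsbrun–Lemke Oliver 2014 Thm. 3.3)] -/
theorem bsdRHS_eq_of_isIsogenous_of_casselsTate_adjoint_of_selmerRatioFormula
    (hCT : exists_casselsTate_pairing_adjoint ℚ)
    (hCF : Literature.NumberTheory.EllipticCurves.Cassels1965.selmerRatioFormula)
    (hLOC : ∀ (W W' : WeierstrassCurve ℚ) [W.IsElliptic] [W'.IsElliptic] [W.IsGloballyMinimal]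
      [W'.IsGloballyMinimal] (φ : Isogeny W W'),
      (selmerRatio φ : ℝ) * (W.realPeriodRat * W.tamagawaProduct) =
        W'.realPeriodRat * W'.tamagawaProduct) :
    bsdRHS_eq_of_isIsogenous :=
  bsdRHS_eq_of_isIsogenous_of_casselsTate_adjoint_of_casselsFormula hCT hCF.rat hLOC

/-- The same with (CT) in the tree's other functorial form `casselsTate_pairing_functorial ℚ`.
[cite: MilneADT2006, Ch. I, Thm. 7.3 and proof; Prop. 6.9, Rem. 6.10(a), Thm. 6.13(a)] -/
theorem bsdRHS_eq_of_isIsogenous_of_casselsTate_functorial_of_selmerRatioFormula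
    (hCT : casselsTate_pairing_functorial ℚ)
    (hCF : Literature.NumberTheory.EllipticCurves.Cassels1965.selmerRatioFormula)
    (hLOC : ∀ (W W' : WeierstrassCurve ℚ) [W.IsElliptic] [W'.IsElliptic] [W.IsGloballyMinimal]
      [W'.IsGloballyMinimal] (φ : Isogeny W W'),
      (selmerRatio φ : ℝ) * (W.realPeriodRat * W.tamagawaProduct) =
        W'.realPeriodRat * W'.tamagawaProduct) :
    bsdRHS_eq_of_isIsogenous :=
  bsdRHS_eq_of_isIsogenous_of_casselsTate_functorial_of_casselsFormula hCT hCF.rat hLOC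

/-- **Per-pair form for ANY degree** (the all-degree twin of
`bsdRHS_eq_of_casselsTate_of_casselsFormula_selmerRatio_three`): for a `ℚ`-isogeny `φ : E → E'` of
elliptic curves with dual `ψ` (`ψ ∘ φ = [deg φ]`), Cassels–Tate pairings adjoint for `(Ш(φ), Ш(ψ))`
(CT, for this pair), Cassels' Selmer-ratio formula (the tree's named fact
`Cassels1965.selmerRatioFormula`), the local evaluation (LOC, for this pair and these models) and
`Ш(E/ℚ)` finite: `E` and `E'` have the same Birch–Swinnerton-Dyer quotient.  Polymorphic in the
`DecidableEq ℚ` instance of the group law.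
[cite: MilneADT2006, Ch. I, Thm. 7.3 and proof, (7.3.1), pp. 97–100] -/
theorem bsdRHS_eq_of_casselsTate_of_selmerRatioFormula [DecidableEq ℚ]
    [W.IsElliptic] [W'.IsElliptic] (φ : Isogeny W W') (ψ : Isogeny W' W)
    (hψφ : ∀ P : W.geomPoints, ψ (φ P) = (φ.degree : ℤ) • P)
    (f : W.toAffine.Point →+ W'.toAffine.Point)
    (hf : ∀ P, W'.toGeomPoints (f P) = φ (W.toGeomPoints P))
    (g : W'.toAffine.Point →+ W.toAffine.Point)
    (hg : ∀ Q, W.toGeomPoints (g Q) = ψ (W'.toGeomPoints Q))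
    (hCT : ∃ (B : W.sha →+ W.sha →+ AddCircle (1 : ℚ)) (B' : W'.sha →+ W'.sha →+ AddCircle (1 : ℚ)),
      (∀ x, B x x = 0) ∧ (∀ x, (∀ y, B x y = 0) → x ∈ AddSubgroup.divisibleElements W.sha) ∧
      (∀ x, B' x x = 0) ∧ (∀ x, (∀ y, B' x y = 0) → x ∈ AddSubgroup.divisibleElements W'.sha) ∧
      ∀ a b', B' (shaMap φ.toAddMonoidHom φ.equivariant φ.hasLocalPointsMaps_toAddMonoidHom a) b' =
        B a (shaMap ψ.toAddMonoidHom ψ.equivariant ψ.hasLocalPointsMaps_toAddMonoidHom b'))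
    (hCF : Literature.NumberTheory.EllipticCurves.Cassels1965.selmerRatioFormula)
    (hLOC : (selmerRatio φ : ℝ) * (W.realPeriodRat * W.tamagawaProduct) =
      W'.realPeriodRat * W'.tamagawaProduct)
    (hfin : W.ShaFinite) : W'.bsdRHS = W.bsdRHS :=
  bsdRHS_eq_of_casselsTate_of_keyIdentity φ ψ hψφ f hf g hg hCT
    (keyIdentity_of_casselsFormula_of_selmerRatio_eq φ ψ f hf g hg (hCF ℚ W W' φ ψ hψφ) hLOC) hfin

end Rat

end WeierstrassCurve

end
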